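import Summits.CriticalPhenomena.SAWScalingLimit.Theorems.SAWDefectDecoherenceBoundaryClosureRPolygonLocalFlat
import Mathlib.Order.Filter.Ultrafilter.Basic
import Mathlib.Order.Filter.Cofinite
import HarnessLib

/-!
# The boundary phase function `κ` of a polygon family along a mesh sequence
(crux `BoundaryClosureR`, stmt-CriticalPhenomena-14004, line `polygon-parity-squeeze`, sub-goal of the
registered stub `polygonLocalIdentity`, steps (a)–(b); registered helper `exists_boundaryPhase`)

For an admissible pinned family along a mesh sequence `ns → 0⁺` we construct

* lattice phases `Θ_n(z)`: the phase `F(e')|F₀(b)|/(|F₀(e')| F(b))` of some boundary dart `e'` of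
  `Λ_{ns n}` within `7S(z)/8` of `z` (`S(z)` = the supremum of the flat radii at `z`; `Θ_n(z) = 1` if
  there is no such dart), unimodular eventually (`boundary_norms`);
* the limit phase `κ(z) = lim_𝒰 Θ_n(z)` along a non-principal ultrafilter `𝒰 ≤ atTop` (it exists in the
  unit circle by compactness, for EVERY `z` simultaneously — no diagonal subsequence is needed), so
  `‖κ z‖ = 1`;
* **the phase property**: on every flat ball `B(z, s)` off the root (eventually exact half-lattice of
  form `k` on the ball), eventually every boundary dart `v ∼ t` with `δ c_v ∈ B(z, 3s/4)` satisfies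
  `F(vt)|F₀(b)| = Θ_n(z) |F₀(vt)| F(b)` (`flat_phase_eq` on the ball of radius `15 S(z)/16`).

References: Duminil-Copin–Smirnov 2012 §3.  No definition is introduced (all objects are local).
-/

noncomputable section

open scoped Topology ComplexConjugate Classical
open Filter Set Metric
open Literature.Probability.LatticeModels Literature.Probability.RandomPlanarGeometry
open Literature.Probability.RandomPlanarGeometry.SAW
open Summit.CriticalPhenomena.SAWScalingLimit.Theorems.PickHalfPlane
open Summit.CriticalPhenomena.SAWScalingLimit.Theorems (ConjugateClassNegligibleSynthesis.dist_mid_center_le)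

namespace Summit.CriticalPhenomena.SAWScalingLimit.Theorems.PolygonParitySqueeze.PolygonLocal

/-- **The boundary phase function** (registered helper `exists_boundaryPhase` of `polygonLocalIdentity`):
see the module docstring. [cite: DuminilCopinSmirnov2012, §3 (winding of walks to the boundary)] -/
theorem exists_boundaryPhase : ∀ (D : DobrushinDomain) (ρ : ℝ) (Λ : ℝ → Finset HexVertex) (m : ℝ → ℤ) (b : ℝ → Sym2 HexVertex), AdmissibleFamily D ρ Λ m b → ∀ (a : ℝ → Sym2 HexVertex) (r₀ : ℝ) (m₀ : ℝ → ℤ), PinnedFlatRoot D Λ b (D.pt 0) a r₀ m₀ → ∀ (ns : ℕ → ℝ), Filter.Tendsto ns Filter.atTop (𝓝[>] 0) → ∃ (U : Filter ℕ) (Θ : ℕ → ℂ → ℂ) (κ : ℂ → ℂ), U ≤ Filter.atTop ∧ U.NeBot ∧ (∀ z : ℂ, Filter.Tendsto (fun n => Θ n z) U (𝓝 (κ z))) ∧ (∀ z : ℂ, ‖κ z‖ = 1) ∧ (∀ (z : ℂ) (k : Fin 6) (s : ℝ), 0 < s → (∀ᶠ δ : ℝ in 𝓝[>] 0, ∃ nthr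 : ℤ, ∀ v : HexVertex, (δ : ℂ) * hexCenter v ∈ Metric.ball z s → (v ∈ Λ δ ↔ nthr ≤ zigzagForm k v)) → D.pt 0 ∉ Metric.closedBall z s → ∀ᶠ n : ℕ in Filter.atTop, ∀ v t : HexVertex, v ∈ Λ (ns n) → t ∉ Λ (ns n) → hexGraph.Adj v t → ((ns n : ℝ) : ℂ) * hexCenter v ∈ Metric.ball z (3 * s / 4) → hexParafermionicObservable (Λ (ns n)) (a (ns n)) hexCriticalFugacity (5 / 8) s(v, t) * ((‖hexParafermionicObservable (Λ (ns n)) (a (ns n)) hexCriticalFugacity 0 (b (ns n))‖ : ℝ) : ℂ) = Θ n z * ((‖hexParafermionicObservable (Λ (ns n)) (a (ns n)) hexCriticalFugacity 0 s(v, t)‖ : ℝ) : ℂ) * hexParafermionicObservable (Λ (ns n)) (a (ns n)) hexCriticalFugacity (5 / 8) (b (ns n))) := by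
  intro D ρ Λ m b hAF a r₀ m₀ hPR ns hns
  ---------------------------------------------------------------- notation
  set F : ℕ → Sym2 HexVertex → ℂ := fun n e =>
    hexParafermionicObservable (Λ (ns n)) (a (ns n)) hexCriticalFugacity (5 / 8) e with hFdef
  set Z : ℕ → Sym2 HexVertex → ℝ := fun n e =>
    ‖hexParafermionicObservable (Λ (ns n)) (a (ns n)) hexCriticalFugacity 0 e‖ with hZdef
  ---------------------------------------------------------------- flat radii and their supremum
  set FL : ℂ → Set ℝ := fun z => {s : ℝ | 0 < s ∧ (∃ k : Fin 6, ∀ᶠ δ : ℝ in 𝓝[>] 0, ∃ nthr : ℤ,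
      ∀ v : HexVertex, (δ : ℂ) * hexCenter v ∈ ball z s → (v ∈ Λ δ ↔ nthr ≤ zigzagForm k v)) ∧
      D.pt 0 ∉ closedBall z s} with hFL
  set Sz : ℂ → ℝ := fun z => sSup (FL z) with hSz
  have hFLbdd : ∀ z, BddAbove (FL z) := fun z => ⟨dist (D.pt 0) z, fun s hs => by
    obtain ⟨-, -, h⟩ := hs
    rw [mem_closedBall, not_le] at h
    exact h.le⟩
  have hFLdown : ∀ z s s', s ∈ FL z → 0 < s' → s' ≤ s → s' ∈ FL z := by
    rintro z s s' ⟨-, ⟨k, hk⟩, hr⟩ hs' hle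
    refine ⟨hs', ⟨k, ?_⟩, fun h => hr (closedBall_subset_closedBall hle h)⟩
    filter_upwards [hk] with δ ⟨nthr, h⟩
    exact ⟨nthr, fun v hv => h v (ball_subset_ball hle hv)⟩
  have hFLle : ∀ z s, s ∈ FL z → s ≤ Sz z := fun z s hs => le_csSup (hFLbdd z) hs
  have hFLfrac : ∀ z s, s ∈ FL z → ∀ c : ℝ, 0 < c → c < 1 → c * Sz z ∈ FL z := by
    intro z s hs c hc hc1
    have hS0 : 0 < Sz z := lt_of_lt_of_le hs.1 (hFLle z s hs)
    obtain ⟨s', hs', hlt⟩ := exists_lt_of_lt_csSup ⟨s, hs⟩ (show c * Sz z < Sz z by nlinarith)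
    exact hFLdown z s' _ hs' (by positivity) hlt.le
  ---------------------------------------------------------------- the lattice phases
  set Θ : ℕ → ℂ → ℂ := fun n z =>
    if h : ∃ p : HexVertex × HexVertex, p.1 ∈ Λ (ns n) ∧ p.2 ∉ Λ (ns n) ∧ hexGraph.Adj p.1 p.2 ∧
        ((ns n : ℝ) : ℂ) * hexCenter p.1 ∈ ball z (7 * Sz z / 8) then
      F n s(h.choose.1, h.choose.2) * ((Z n (b (ns n)) : ℝ) : ℂ) /
        (((Z n s(h.choose.1, h.choose.2) : ℝ) : ℂ) * F n (b (ns n)))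
    else 1 with hΘ
  have hnorm := hns.eventually (boundary_norms hAF hPR)
  -- unimodular, eventually
  have hΘ1 : ∀ z, ∀ᶠ n in atTop, ‖Θ n z‖ = 1 := by
    intro z
    filter_upwards [hnorm] with n hn
    obtain ⟨hne, hbmem⟩ := hn
    simp only [hΘ]
    split_ifs with hc
    · obtain ⟨hv, ht, hvt, -⟩ := hc.choose_spec
      have he : s(hc.choose.1, hc.choose.2) ∈ hexDomainBoundary (Λ (ns n)) :=
        ⟨(SimpleGraph.mem_edgeSet _).2 hvt, _, _, Sym2.eq_swap, hv, ht⟩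
      obtain ⟨he1, he2⟩ := hne _ he
      obtain ⟨hb1, hb2⟩ := hne _ hbmem
      rw [norm_div, norm_mul, norm_mul, Complex.norm_real, Complex.norm_real, Real.norm_of_nonneg (norm_nonneg _),
        Real.norm_of_nonneg (norm_nonneg _)]
      simp only [hFdef] at he1 hb1 he2 hb2 ⊢
      rw [he1, hb1]
      field_simp
    · exact norm_one
  ---------------------------------------------------------------- the limit phase along an ultrafilter
  set U : Filter ℕ := ((hyperfilter ℕ : Ultrafilter ℕ) : Filter ℕ) with hU
  have hUle : U ≤ atTop := by rw [hU, ← Nat.cofinite_eq_atTop]; exact hyperfilter_le_cofinite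
  haveI hUne : U.NeBot := by rw [hU]; infer_instance
  have hlim : ∀ z, ∃ L : ℂ, ‖L‖ = 1 ∧ Tendsto (fun n => Θ n z) U (𝓝 L) := by
    intro z
    have hmem : sphere (0 : ℂ) 1 ∈ Filter.map (fun n => Θ n z) U :=
      ((hΘ1 z).filter_mono hUle).mono fun n hn => mem_sphere_zero_iff_norm.2 hn
    obtain ⟨L, hL, hle⟩ := (isCompact_sphere (0 : ℂ) 1).ultrafilter_le_nhds
      ((hyperfilter ℕ).map fun n => Θ n z) (by rw [Ultrafilter.coe_map, le_principal_iff]; exact hmem)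
    exact ⟨L, mem_sphere_zero_iff_norm.1 hL, by rw [Ultrafilter.coe_map] at hle; exact hle⟩
  set κ : ℂ → ℂ := fun z => limUnder U (fun n => Θ n z) with hκ
  have hκT : ∀ z, Tendsto (fun n => Θ n z) U (𝓝 (κ z)) := fun z => by
    obtain ⟨L, -, hL⟩ := hlim z
    exact tendsto_nhds_limUnder ⟨L, hL⟩
  have hκ1 : ∀ z, ‖κ z‖ = 1 := fun z => by
    obtain ⟨L, hL1, hL⟩ := hlim z
    rw [← tendsto_nhds_unique (hκT z) hL] at hL1
    exact hL1
  refine ⟨U, Θ, κ, hUle, hUne, hκT, hκ1, ?_⟩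
  ---------------------------------------------------------------- the phase property
  intro z k s hs hex hroot
  have hsFL : s ∈ FL z := ⟨hs, ⟨k, hex⟩, hroot⟩
  have hsS : s ≤ Sz z := hFLle z s hsFL
  have hS0 : 0 < Sz z := lt_of_lt_of_le hs hsS
  obtain ⟨-, ⟨k', hex'⟩, hroot'⟩ := hFLfrac z s hsFL (15 / 16) (by norm_num) (by norm_num)
  have hphase := hns.eventually (flat_phase_eq D ρ Λ m b hAF a r₀ m₀ hPR z k' (15 / 16 * Sz z)
    (29 / 32 * Sz z) (by nlinarith) hex' hroot')
  have hsmall : ∀ᶠ n in atTop, ns n < Sz z / 32 :=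
    hns.eventually (nhdsWithin_le_nhds (eventually_lt_nhds (by positivity)))
  have hpos := hns.eventually (self_mem_nhdsWithin : Ioi (0 : ℝ) ∈ 𝓝[>] (0 : ℝ))
  filter_upwards [hphase, hnorm, hsmall, hpos] with n hp hn hnS hn0 v t hv ht hvt hvb
  obtain ⟨hne, hbmem⟩ := hn
  have hn0' : (0 : ℝ) ≤ ns n := le_of_lt hn0
  -- the defining dart of `Θ n z` exists
  have hcond : ∃ p : HexVertex × HexVertex, p.1 ∈ Λ (ns n) ∧ p.2 ∉ Λ (ns n) ∧ hexGraph.Adj p.1 p.2 ∧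
      ((ns n : ℝ) : ℂ) * hexCenter p.1 ∈ ball z (7 * Sz z / 8) :=
    ⟨(v, t), hv, ht, hvt, ball_subset_ball (by nlinarith) hvb⟩
  have hΘnz : Θ n z = F n s(hcond.choose.1, hcond.choose.2) * ((Z n (b (ns n)) : ℝ) : ℂ) /
      (((Z n s(hcond.choose.1, hcond.choose.2) : ℝ) : ℂ) * F n (b (ns n))) := by
    simp only [hΘ]; rw [dif_pos hcond]
  set p' : HexVertex × HexVertex := hcond.choose with hp'
  obtain ⟨hv', ht', hvt', hb'⟩ := hcond.choose_spec
  have he : s(v, t) ∈ hexDomainBoundary (Λ (ns n)) := ⟨(SimpleGraph.mem_edgeSet _).2 hvt, t, v, Sym2.eq_swap, hv, ht⟩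
  have he' : s(p'.1, p'.2) ∈ hexDomainBoundary (Λ (ns n)) :=
    ⟨(SimpleGraph.mem_edgeSet _).2 hvt', _, _, Sym2.eq_swap, hv', ht'⟩
  -- both midpoints lie in `B(z, 29 S/32)`
  have hmid : ((ns n : ℝ) : ℂ) * hexMidpoint s(v, t) ∈ ball z (29 / 32 * Sz z) := by
    have h1 := ConjugateClassNegligibleSynthesis.dist_mid_center_le hn0' hvt
    have h2 := mem_ball.1 hvb
    rw [mem_ball]
    have := dist_triangle (((ns n : ℝ) : ℂ) * hexMidpoint s(v, t)) (((ns n : ℝ) : ℂ) * hexCenter v) z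
    nlinarith
  have hmid' : ((ns n : ℝ) : ℂ) * hexMidpoint s(p'.1, p'.2) ∈ ball z (29 / 32 * Sz z) := by
    have h1 := ConjugateClassNegligibleSynthesis.dist_mid_center_le hn0' hvt'
    have h2 := mem_ball.1 hb'
    rw [mem_ball]
    have := dist_triangle (((ns n : ℝ) : ℂ) * hexMidpoint s(p'.1, p'.2)) (((ns n : ℝ) : ℂ) * hexCenter p'.1) z
    nlinarith
  have hpe := hp _ he _ he' hmid hmid'
  -- norms
  obtain ⟨hb1, hb2⟩ := hne _ hbmem
  obtain ⟨-, he2'⟩ := hne _ he'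
  have hZb : (((Z n (b (ns n))) : ℝ) : ℂ) ≠ 0 := Complex.ofReal_ne_zero.2 hb2.ne'
  have hZe' : (((Z n s(p'.1, p'.2)) : ℝ) : ℂ) ≠ 0 := Complex.ofReal_ne_zero.2 he2'.ne'
  have hFb : F n (b (ns n)) ≠ 0 := by
    intro h0
    simp only [hFdef] at h0 hb1
    rw [h0, norm_zero] at hb1
    exact hb2.ne' hb1.symm
  rw [hΘnz, div_mul_eq_mul_div, div_mul_eq_mul_div, eq_div_iff (mul_ne_zero hZe' hFb)]
  simp only [hFdef, hZdef] at hpe hZb hZe' hFb ⊢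
  linear_combination (((‖hexParafermionicObservable (Λ (ns n)) (a (ns n)) hexCriticalFugacity 0 (b (ns n))‖ : ℝ) : ℂ) *
    hexParafermionicObservable (Λ (ns n)) (a (ns n)) hexCriticalFugacity (5 / 8) (b (ns n))) * hpe

end Summit.CriticalPhenomena.SAWScalingLimit.Theorems.PolygonParitySqueeze.PolygonLocal

end
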